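import Mathlib
import HarnessLib
import Literature.MathematicalPhysics.QuantumLattice.SectorisedKernelNormRefinementPlateauPrescribed
import Literature.MathematicalPhysics.QuantumLattice.SectorisedKernelNormRefinementFlatCount
import Summits.HubbardSuperconductivity.HubbardSuperconductivity.Theorems.KLProgrammeKLRegimeEngineNormsJumpResectorisation

/-!
# Route `KLProgramme` — crux K3 ENGINE, item stmt-HubbardSuperconductivity-20437 `KLRegimeEngineV17F2`, stub (b) `stub_engine_step_norms`
# (clause (E1), blocked birth-level tower, LEVELS track): RE-SECTORISATION AT A JUMP `k → J′` WITH PRESCRIBED LEGS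

Cell gate-hubbard-kl, seat hubbard-kl-k3c2-p3 (g6); E1-TOWER-BLOCKED v3 §10 (U7-(c1) located in the LEVELS track; (Hμ-L)): the tower carries the
born sizes of the kernels BY THE NUMBER OF KNOWN EXTERNAL SECTORS (BGM 2006 §2.8 (2.88)–(2.90), App. A3 Lemma A3.1: a vertex with `F` prescribed legs
is estimated by its anchored norm with those sectors held fixed and one further leg pinned), and an increment born at the block boundary `J_{k′}`
is re-measured at a later boundary `J′` in the thin family of index `J′` with the SPLIT relative count of p4's correlated counting (off / on the
umklapp-corner class).  This file is the KL-vocabulary instance of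
`Literature.…SectorisedKernelNormRefinementPlateauPrescribed.hubbardSectorPrescribedSum_refine_le_split_of_plateau_pair` for the plateau pair
`(klAnisoFamily k, bgmFatMultiplier k ; klAnisoFamily J′)`, `k + 1 ≤ J′`, child relation := support overlap — the INTERMEDIATE tracks between
`EngineV8.hubbardSectorKernelNorm_klAniso_jump_le_of_relCount_split` (one leg prescribed, `…EngineNormsJumpResectorisation`) and
`EngineV8.hubbardSectorPinnedSum_klAniso_jump_le` (all legs prescribed):

* `card_parentsLeg_klAniso_le` — per leg, a thin label of index `J′` overlaps (support overlap of the sector index with the fat multiplier of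
  index `k ≤ J′`, same spin and charge) at most `27` labels of index `k` (p4's `card_overlap_klAniso_bgmFat_coarse_le`);
* **`hubbardSectorPrescribedSum_klAniso_jump_le_split`** — for a set `E` of legs with prescribed `klAnisoFamily J′`-labels `τ″|_E`, a
  position-pinned leg `p ∈ E`, per-pair column sums `≤ c₁` and row sums `≤ c₁r` of `‖E(klAnisoFamily J′)·S(F̃_k)‖` (labels matched), split
  refinement counts AT FIXED PRESCRIPTION `R₁` (coarse tuple off the class `B`) / `R₂` (on `B`), and bounds `N₁` / `N₂` on the level-`k`
  prescribed sums over all coarse tuples / over `B`: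
  `ε^m Σ_{σ″ ∈ A″, σ″|_E = τ″|_E} Σ_{x″_p = x} ‖W_{J′,σ″}(x″)‖ ≤ c₁^m · c₁r · 27^{|E|} · ε^m · (ε · (R₁ N₁ + R₂ N₂))`.

* `card_relCount_prescribed_flat_klAniso_le` — the FLAT refinement count at fixed prescription, discharged: `R(E, J′−k) ≤ (27·2^{J′−k})^{(m+1)−|E|}`
  (one factor per free leg, p4's `card_overlap_klAniso_bgmFat_fine_le`; no conservation improvement — the default `hRoff`/`hRon` row where the
  relative sector counting gain is not load-bearing, E1-TOWER-BLOCKED §10(a) high degrees).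

The inputs are counting-lane rows: `c₁`, `c₁r` = p4's overlap-kernel sums (per matched label pair), `R₁(E)`, `R₂(E)` = the split relative counts
with the legs of `E` prescribed (E1-TOWER-BLOCKED §10 (d)), `N₁`, `N₂` = the level-`k` track sizes.  Everything is proved; no definitions;
nothing about the model is asserted beyond this implication.
-/

noncomputable section

namespace Summit.HubbardSuperconductivity.HubbardSuperconductivity.Theorems.EngineV8

set_option linter.dupNamespace false -- summit = problem name (single-conjunct summit), D-0017

open Classical
open Real Finset Literature.MathematicalPhysics.QuantumLattice Literature.Probability.LatticeModels GrassmannAlgebra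
open Summit.HubbardSuperconductivity.HubbardSuperconductivity.Theorems.KLProgrammeLegKernels
open Summit.HubbardSuperconductivity.HubbardSuperconductivity.Theorems.KLRegimeSplit
open Summit.HubbardSuperconductivity.HubbardSuperconductivity.Theorems.TorusFourierL2

variable {L M : ℕ} [NeZero L] [NeZero M]

omit [NeZero M] in
/-- **The parents of one leg, counted**: a label `ℓ″` of the thin family of index `J′` overlaps (support overlap of the sector index with the
fat multiplier of index `k ≤ J′`, same spin and charge) at most `27` labels of index `k` — p4's `card_overlap_klAniso_bgmFat_coarse_le`
transported along the injection `ℓ′ ↦ ℓ′.ω`. -/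
theorem card_parentsLeg_klAniso_le (β μ : ℝ) (K : TrigPolyC4v) {k J' : ℕ} (hkJ : k ≤ J') (ℓ'' : SectorLeg (sectorCount J')) :
    (((univ.filter fun ℓ' : SectorLeg (sectorCount k) =>
        (∃ q : FreqMomentum L M, klAnisoFamily L M β μ K klE0 J' ℓ''.1.1 q ≠ 0 ∧
          bgmFatMultiplier L M klE0 β (nambuXiCT L μ K) k ℓ'.1.1 q ≠ 0) ∧
        ℓ'.1.2 = ℓ''.1.2 ∧ ℓ'.2 = ℓ''.2).card : ℝ)) ≤ 27 := by
  have he : (0 : ℝ) < klE0 := by norm_num [klE0]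
  have h : (univ.filter fun ℓ' : SectorLeg (sectorCount k) =>
        (∃ q : FreqMomentum L M, klAnisoFamily L M β μ K klE0 J' ℓ''.1.1 q ≠ 0 ∧
          bgmFatMultiplier L M klE0 β (nambuXiCT L μ K) k ℓ'.1.1 q ≠ 0) ∧
        ℓ'.1.2 = ℓ''.1.2 ∧ ℓ'.2 = ℓ''.2).card ≤ 27 := by
    calc (univ.filter fun ℓ' : SectorLeg (sectorCount k) =>
          (∃ q : FreqMomentum L M, klAnisoFamily L M β μ K klE0 J' ℓ''.1.1 q ≠ 0 ∧
            bgmFatMultiplier L M klE0 β (nambuXiCT L μ K) k ℓ'.1.1 q ≠ 0) ∧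
          ℓ'.1.2 = ℓ''.1.2 ∧ ℓ'.2 = ℓ''.2).card
        ≤ ((univ : Finset (Fin (sectorCount k))).filter (fun ω₂ : Fin (sectorCount k) =>
            ∃ q : FreqMomentum L M, klAnisoFamily L M β μ K klE0 J' ℓ''.1.1 q ≠ 0 ∧
              bgmFatMultiplier L M klE0 β (nambuXiCT L μ K) k ω₂ q ≠ 0)).card := by
          refine Finset.card_le_card_of_injOn (fun ℓ' : SectorLeg (sectorCount k) => ℓ'.1.1) (fun ℓ' hℓ' => ?_)
            (fun ℓ₁ h₁ ℓ₂ h₂ heq => ?_)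
          · simp only [mem_coe, mem_filter, mem_univ, true_and] at hℓ' ⊢
            exact hℓ'.1
          · simp only [mem_coe, mem_filter, mem_univ, true_and] at h₁ h₂
            exact Prod.ext (Prod.ext heq (h₁.2.1.trans h₂.2.1.symm)) (h₁.2.2.trans h₂.2.2.symm)
      _ ≤ 27 := card_overlap_klAniso_bgmFat_coarse_le he β μ K hkJ _
  exact_mod_cast h

/-- **Re-sectorisation at a jump with PRESCRIBED LEGS and the split relative count** (BGM 2006 §2.8 (2.82)–(2.84), (2.88)–(2.90), App. A3 Lemma A3.1;
the LEVELS track of the blocked birth-level tower, E1-TOWER-BLOCKED §10 (Hμ-L)): for `k + 1 ≤ J′`, every Grassmann polynomial `G`, degree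
`m + 1`, constraint set `A″` of `klAnisoFamily J′`-label tuples, set `E` of legs with prescribed labels `τ″|_E`, position-pinned leg `p ∈ E`,
class `B` of coarse (`klAnisoFamily k`) label tuples; given per-pair column sums `≤ c₁` and row sums `≤ c₁r` of `‖E(klAnisoFamily J′)·S(F̃_k)‖`
(labels matched), refinement counts at fixed prescription `#{σ″ ∈ A″ : σ″|_E = τ″|_E, σ″ overlaps σ′ leg by leg} ≤ R₁` for `σ′ ∉ B`, `≤ R₂` for
`σ′ ∈ B`, and bounds `N₁` (all `σ′`) / `N₂` (`σ′ ∈ B`) on the level-`k` prescribed sums `ε^m Σ_{σ′|_E = τ′|_E} Σ_{x′_p = y} ‖W_{k,σ′}(x′)‖`: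
`ε^m Σ_{σ″ ∈ A″, σ″|_E = τ″|_E} Σ_{x″_p = x} ‖W_{J′,σ″}(x″)‖ ≤ c₁^m · c₁r · 27^{|E|} · ε^m · (ε · (R₁ · N₁ + R₂ · N₂))`. -/
theorem hubbardSectorPrescribedSum_klAniso_jump_le_split {β : ℝ} (hβ : 0 < β) (μ : ℝ) (K : TrigPolyC4v) {k J' : ℕ} (hJ : k + 1 ≤ J')
    (G : HubbardGrassmann L M) {c₁ c₁r R₁ R₂ N₁ N₂ : ℝ} (hc₁0 : 0 ≤ c₁) (hc₁r0 : 0 ≤ c₁r) (hR₁ : 0 ≤ R₁) (hR₂ : 0 ≤ R₂)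
    (hN₁0 : 0 ≤ N₁) (hN₂0 : 0 ≤ N₂)
    (hcol₁ : ∀ (ω'' : Fin (sectorCount J')) (ω' : Fin (sectorCount k)) (σ c : Fin 2) (x' : SpaceTimeIdx L M),
      ∑ x'' : SpaceTimeIdx L M, ‖(sectorAnalysisMatrix L M β (klAnisoFamily L M β μ K klE0 J') *
        sectorSubMatrix L M β (bgmFatMultiplier L M klE0 β (nambuXiCT L μ K) k)) (x'', ((ω'', σ), c)) (x', ((ω', σ), c))‖ ≤ c₁)
    (hrow₁ : ∀ (ω'' : Fin (sectorCount J')) (ω' : Fin (sectorCount k)) (σ c : Fin 2) (x'' : SpaceTimeIdx L M),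
      ∑ x' : SpaceTimeIdx L M, ‖(sectorAnalysisMatrix L M β (klAnisoFamily L M β μ K klE0 J') *
        sectorSubMatrix L M β (bgmFatMultiplier L M klE0 β (nambuXiCT L μ K) k)) (x'', ((ω'', σ), c)) (x', ((ω', σ), c))‖ ≤ c₁r)
    (m : ℕ) (A'' : Finset (Fin (m + 1) → SectorLeg (sectorCount J'))) (B : Finset (Fin (m + 1) → SectorLeg (sectorCount k)))
    (E : Finset (Fin (m + 1))) (τ'' : Fin (m + 1) → SectorLeg (sectorCount J')) (p : Fin (m + 1)) (hp : p ∈ E)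
    (hRoff : ∀ σ' : Fin (m + 1) → SectorLeg (sectorCount k), σ' ∉ B →
      (((A''.filter fun σ'' => (∀ e ∈ E, σ'' e = τ'' e) ∧ ∀ i,
          (∃ q : FreqMomentum L M, klAnisoFamily L M β μ K klE0 J' (σ'' i).1.1 q ≠ 0 ∧
            bgmFatMultiplier L M klE0 β (nambuXiCT L μ K) k (σ' i).1.1 q ≠ 0) ∧
          (σ' i).1.2 = (σ'' i).1.2 ∧ (σ' i).2 = (σ'' i).2).card : ℝ)) ≤ R₁)
    (hRon : ∀ σ' : Fin (m + 1) → SectorLeg (sectorCount k), σ' ∈ B →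
      (((A''.filter fun σ'' => (∀ e ∈ E, σ'' e = τ'' e) ∧ ∀ i,
          (∃ q : FreqMomentum L M, klAnisoFamily L M β μ K klE0 J' (σ'' i).1.1 q ≠ 0 ∧
            bgmFatMultiplier L M klE0 β (nambuXiCT L μ K) k (σ' i).1.1 q ≠ 0) ∧
          (σ' i).1.2 = (σ'' i).1.2 ∧ (σ' i).2 = (σ'' i).2).card : ℝ)) ≤ R₂)
    (hN₁ : ∀ (τ' : Fin (m + 1) → SectorLeg (sectorCount k)) (y : SpaceTimeIdx L M),
      imagTimeWeight β M ^ m *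
        ∑ σ' ∈ univ.filter (fun σ' : Fin (m + 1) → SectorLeg (sectorCount k) => ∀ e ∈ E, σ' e = τ' e),
          ∑ x' ∈ univ.filter (fun x' : Fin (m + 1) → SpaceTimeIdx L M => x' p = y),
            ‖sectorisedKernel L M β (klAnisoFamily L M β μ K klE0 k) G (m + 1) σ' x'‖ ≤ N₁)
    (hN₂ : ∀ (τ' : Fin (m + 1) → SectorLeg (sectorCount k)) (y : SpaceTimeIdx L M),
      imagTimeWeight β M ^ m *
        ∑ σ' ∈ B.filter (fun σ' : Fin (m + 1) → SectorLeg (sectorCount k) => ∀ e ∈ E, σ' e = τ' e),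
          ∑ x' ∈ univ.filter (fun x' : Fin (m + 1) → SpaceTimeIdx L M => x' p = y),
            ‖sectorisedKernel L M β (klAnisoFamily L M β μ K klE0 k) G (m + 1) σ' x'‖ ≤ N₂)
    (x : SpaceTimeIdx L M) :
    imagTimeWeight β M ^ m * ∑ σ'' ∈ A''.filter (fun σ'' => ∀ e ∈ E, σ'' e = τ'' e),
        ∑ x'' ∈ univ.filter (fun x'' : Fin (m + 1) → SpaceTimeIdx L M => x'' p = x),
          ‖sectorisedKernel L M β (klAnisoFamily L M β μ K klE0 J') G (m + 1) σ'' x''‖ ≤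
      c₁ ^ m * c₁r * 27 ^ E.card * imagTimeWeight β M ^ m * (imagTimeWeight β M * (R₁ * N₁ + R₂ * N₂)) := by
  have he : (0 : ℝ) < klE0 := by norm_num [klE0]
  set F' := klAnisoFamily L M β μ K klE0 J' with hF'
  set F := klAnisoFamily L M β μ K klE0 k with hF
  set Ft := bgmFatMultiplier L M klE0 β (nambuXiCT L μ K) k with hFt
  -- the per-pair position sums for arbitrary label pairs: mismatched spin/charge entries vanish
  have hcol₁' : ∀ (ℓ'' : SectorLeg (sectorCount J')) (X' : SpaceTimeIdx L M × SectorLeg (sectorCount k)),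
      ∑ x'' : SpaceTimeIdx L M, ‖(sectorAnalysisMatrix L M β F' * sectorSubMatrix L M β Ft) (x'', ℓ'') X'‖ ≤ c₁ := by
    rintro ⟨⟨ω'', σ''⟩, c''⟩ ⟨x', ⟨ω', σ'⟩, c'⟩
    by_cases hlab : σ' = σ'' ∧ c' = c''
    · obtain ⟨rfl, rfl⟩ := hlab
      exact hcol₁ ω'' ω' σ' c' x'
    · refine le_of_eq_of_le (sum_eq_zero fun x'' _ => ?_) hc₁0
      rw [sectorAnalysis_mul_sectorSub_apply, if_neg (by exact hlab), norm_zero]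
  have hrow₁' : ∀ (X'' : SpaceTimeIdx L M × SectorLeg (sectorCount J')) (ℓ' : SectorLeg (sectorCount k)),
      ∑ x' : SpaceTimeIdx L M, ‖(sectorAnalysisMatrix L M β F' * sectorSubMatrix L M β Ft) X'' (x', ℓ')‖ ≤ c₁r := by
    rintro ⟨x'', ⟨ω'', σ''⟩, c''⟩ ⟨⟨ω', σ'⟩, c'⟩
    by_cases hlab : σ' = σ'' ∧ c' = c''
    · obtain ⟨rfl, rfl⟩ := hlab
      exact hrow₁ ω'' ω' σ' c' x''
    · refine le_of_eq_of_le (sum_eq_zero fun x' _ => ?_) hc₁r0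
      rw [sectorAnalysis_mul_sectorSub_apply, if_neg (by exact hlab), norm_zero]
  have h := hubbardSectorPrescribedSum_refine_le_split_of_plateau_pair hβ F Ft
    (fun ω q => bgmFatMultiplier_mul_bgmMultiplier he β (nambuXiCT L μ K) k ω q)
    (fun q hq ω => klAnisoFamily_eq_zero_of_sum_eq_zero β μ K klE0 k q hq ω) F'
    (fun ω' q hne => sum_klAnisoFamily_eq_one_of_klAnisoFamily_ne_zero β μ K hJ ω' q hne) G
    (fun ω'' ω' => ∃ q : FreqMomentum L M, F' ω'' q ≠ 0 ∧ Ft ω' q ≠ 0)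
    (fun ω'' ω' hno q => by
      by_contra hq
      exact hno ⟨q, (mul_ne_zero_iff.1 hq).1, (mul_ne_zero_iff.1 hq).2⟩)
    hc₁0 hc₁r0 hR₁ hR₂ hN₁0 hN₂0 hcol₁' hrow₁'
    (fun ℓ'' => by convert card_parentsLeg_klAniso_le (L := L) (M := M) β μ K (Nat.le_of_succ_le hJ) ℓ'' using 4)
    m A'' B E τ'' p hp (fun σ' hσ' => by convert hRoff σ' hσ' using 4) (fun σ' hσ' => by convert hRon σ' hσ' using 4) hN₁ hN₂ x
  exact h

omit [NeZero M] in
/-- **The flat refinement count at a jump, discharged**: for `k ≤ J′`, every constraint set `A″` of `klAnisoFamily J′`-label tuples, leg set `E`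
with prescribed labels `τ″|_E` and coarse (`klAnisoFamily k`) label tuple `σ′`: the number of `σ″ ∈ A″` with `σ″|_E = τ″|_E` overlapping `σ′` leg
by leg (support overlap with the fat multiplier, same spin and charge) is `≤ (27·2^{J′−k})^{(m+1)−|E|}` — one factor (children per coarse label,
p4's `card_overlap_klAniso_bgmFat_fine_le`) per FREE leg; no conservation improvement (the default `hRoff`/`hRon` row of
`hubbardSectorPrescribedSum_klAniso_jump_le_split` where the relative-count gain is not load-bearing). -/
theorem card_relCount_prescribed_flat_klAniso_le (β μ : ℝ) (K : TrigPolyC4v) {k J' : ℕ} (hkJ : k ≤ J') (m : ℕ)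
    (A'' : Finset (Fin (m + 1) → SectorLeg (sectorCount J'))) (E : Finset (Fin (m + 1))) (τ'' : Fin (m + 1) → SectorLeg (sectorCount J'))
    (σ' : Fin (m + 1) → SectorLeg (sectorCount k)) :
    (((A''.filter fun σ'' => (∀ e ∈ E, σ'' e = τ'' e) ∧ ∀ i,
        (∃ q : FreqMomentum L M, klAnisoFamily L M β μ K klE0 J' (σ'' i).1.1 q ≠ 0 ∧
          bgmFatMultiplier L M klE0 β (nambuXiCT L μ K) k (σ' i).1.1 q ≠ 0) ∧
        (σ' i).1.2 = (σ'' i).1.2 ∧ (σ' i).2 = (σ'' i).2).card : ℝ)) ≤ ((27 * 2 ^ (J' - k) : ℕ) : ℝ) ^ ((m + 1) - E.card) := by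
  have he : (0 : ℝ) < klE0 := by norm_num [klE0]
  -- per coarse label, the fine labels overlapping it (same spin and charge) inject into the overlapping sector indices
  have hκ : ∀ ℓ' : SectorLeg (sectorCount k), ((univ.filter fun ℓ'' : SectorLeg (sectorCount J') =>
      (∃ q : FreqMomentum L M, klAnisoFamily L M β μ K klE0 J' ℓ''.1.1 q ≠ 0 ∧
        bgmFatMultiplier L M klE0 β (nambuXiCT L μ K) k ℓ'.1.1 q ≠ 0) ∧
      ℓ'.1.2 = ℓ''.1.2 ∧ ℓ'.2 = ℓ''.2).card) ≤ 27 * 2 ^ (J' - k) := by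
    intro ℓ'
    calc (univ.filter fun ℓ'' : SectorLeg (sectorCount J') =>
          (∃ q : FreqMomentum L M, klAnisoFamily L M β μ K klE0 J' ℓ''.1.1 q ≠ 0 ∧
            bgmFatMultiplier L M klE0 β (nambuXiCT L μ K) k ℓ'.1.1 q ≠ 0) ∧
          ℓ'.1.2 = ℓ''.1.2 ∧ ℓ'.2 = ℓ''.2).card
        ≤ ((univ : Finset (Fin (sectorCount J'))).filter (fun ω₁ : Fin (sectorCount J') =>
            ∃ q : FreqMomentum L M, klAnisoFamily L M β μ K klE0 J' ω₁ q ≠ 0 ∧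
              bgmFatMultiplier L M klE0 β (nambuXiCT L μ K) k ℓ'.1.1 q ≠ 0)).card := by
          refine Finset.card_le_card_of_injOn (fun ℓ'' : SectorLeg (sectorCount J') => ℓ''.1.1) (fun ℓ'' hℓ'' => ?_)
            (fun ℓ₁ h₁ ℓ₂ h₂ heq => ?_)
          · simp only [mem_coe, mem_filter, mem_univ, true_and] at hℓ'' ⊢
            exact hℓ''.1
          · simp only [mem_coe, mem_filter, mem_univ, true_and] at h₁ h₂
            exact Prod.ext (Prod.ext heq (h₁.2.1.symm.trans h₂.2.1)) (h₁.2.2.symm.trans h₂.2.2)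
      _ ≤ 27 * 2 ^ (J' - k) := card_overlap_klAniso_bgmFat_fine_le he β μ K hkJ _
  have h := card_filter_prescribed_children_le
    (fun (ℓ'' : SectorLeg (sectorCount J')) (ℓ' : SectorLeg (sectorCount k)) =>
      (∃ q : FreqMomentum L M, klAnisoFamily L M β μ K klE0 J' ℓ''.1.1 q ≠ 0 ∧
        bgmFatMultiplier L M klE0 β (nambuXiCT L μ K) k ℓ'.1.1 q ≠ 0) ∧
      ℓ'.1.2 = ℓ''.1.2 ∧ ℓ'.2 = ℓ''.2)
    (fun ℓ' => by convert hκ ℓ' using 2) A'' E τ'' σ'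
  have h' : ((A''.filter fun σ'' => (∀ e ∈ E, σ'' e = τ'' e) ∧ ∀ i,
        (∃ q : FreqMomentum L M, klAnisoFamily L M β μ K klE0 J' (σ'' i).1.1 q ≠ 0 ∧
          bgmFatMultiplier L M klE0 β (nambuXiCT L μ K) k (σ' i).1.1 q ≠ 0) ∧
        (σ' i).1.2 = (σ'' i).1.2 ∧ (σ' i).2 = (σ'' i).2).card) ≤ (27 * 2 ^ (J' - k)) ^ ((m + 1) - E.card) := by
    convert h using 2
  exact_mod_cast h'

end Summit.HubbardSuperconductivity.HubbardSuperconductivity.Theorems.EngineV8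

end
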